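import Summits.AtomisticToContinuum.BoseEinsteinCondensation.Theses.BECInsertionCorrector
import Summits.AtomisticToContinuum.BoseEinsteinCondensation.Theorems.StaticResponseBound.Negative.Basic
import Literature.MathematicalPhysics.QuantumManyBody.PeriodicBoseGasScatteringODE
import Literature.MathematicalPhysics.QuantumManyBody.PeriodicFormDomain
import Literature.MathematicalPhysics.QuantumManyBody.BoseGasDirichletWall
import HarnessLib

/-!
# Truncation of the pair potential at fixed volume, part 1/2: monotone convergence, the bounded case,
# `liminf` tools and Bose symmetry in momentum space

Helper file (part 1 of 2) for the stub `stub_truncationLimit` (`TruncationLimit`) of line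
`uv-thomson-force-wave` of the crux `BECInsertionCorrector.StaticResponseBound`
(item stmt-AtomisticToContinuum-12057). At fixed `(N, L)` the periodic ground-state energies
`E₀(vₙ) := periodicGroundStateEnergy (truncPotential v n) N L` of the bounded truncations `vₙ = min(v, n)`
increase with `n` and are `≤ E₀(v)`; `TruncationLimit` asks for `E₀(v) ≤ E₀(vₙ) + ε`, `n ≥ n₁(ε)`.
Proved here (all sorry-free, no new definitions):

* `iSup_periodicInteraction_truncPotential` — `W = ⨆ₙ Wₙ` pointwise for the periodic interactions
  `Wₙ = periodicInteraction vₙ L` (a monotone `iSup` commutes with the lattice `tsum` and the pair sum);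
* `iSup_periodicEnergy_truncPotential`, `tendsto_periodicEnergy_truncPotential` — **per-state monotone
  convergence** `periodicEnergy v Ψ = ⨆ₙ periodicEnergy vₙ Ψ` (Beppo Levi) for measurable `v`;
  `monotone_periodicGroundStateEnergy_truncPotential`, `periodicGroundStateEnergy_truncPotential_le'`;
* `truncationLimit_of_bounded` — `TruncationLimit` for a BOUNDED profile `v ≤ M < ⊤` (`vₙ = v`, `n ≥ M`);
* `mul_liminf_le`, `liminf_add_liminf_le`, `tsum_mul_inner_sq_le_liminf` — `liminf` algebra in `ℝ≥0∞`
  and lower semicontinuity of weighted Fourier sums `∑ᵢ wᵢ |⟪eᵢ, ·⟫|²` on a Hilbert space;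
* `configFourierCoeff_perm` — **Bose symmetry in momentum space**: the cell Fourier coefficients of a
  permutation-symmetric `N`-body function are invariant under `n ↦ n ∘ (σ × id)` (change of variables
  `t ↦ t ∘ (σ⁻¹ × id)` on `(ℝ/ℤ)^{3N}`, which preserves the Haar measure);
* small free-gas facts (`periodicEnergy_zero_eq`, `lintegral_periodicInteraction_zero_ne_top`, …) for part 2,
  where the FREE form domain of `PeriodicFormDomain.lean` serves as the compactness device.

No measure-space instance on `ℝ/ℤ` is activated here: the change of variables is stated for an
arbitrary product measure and used with the Haar probability measure baked into `configFourierCoeff`.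

References: B. Simon, *J. Funct. Anal.* 28 (1978) 377–385 (monotone convergence of forms);
[ReedSimonIV1978] Thm XIII.64; [LSSY2005] App. A.
-/

noncomputable section

namespace Summit.AtomisticToContinuum.BoseEinsteinCondensation.Cruxes.StaticResponseBound.UvThomsonForceWave

open MeasureTheory Filter UnitAddTorus
open scoped ENNReal NNReal BigOperators Topology InnerProductSpace
open Literature.MathematicalPhysics.QuantumManyBody.BoseGas

/-! ### Monotone convergence of the truncated interactions and energies -/

/-- The periodised truncated potentials increase with the truncation height. [folklore] -/
theorem monotone_periodizedPotential_truncPotential (v : ℝ → ℝ≥0∞) (L : ℝ) (x : Space) :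
    Monotone fun n : ℕ => periodizedPotential (truncPotential v n) L x :=
  fun _ _ h => ENNReal.tsum_le_tsum fun _ => monotone_truncPotential v _ h

/-- `⨆ₙ (min(v,n))^per = v^per` pointwise. [folklore] -/
theorem iSup_periodizedPotential_truncPotential (v : ℝ → ℝ≥0∞) (L : ℝ) (x : Space) :
    ⨆ n : ℕ, periodizedPotential (truncPotential v n) L x = periodizedPotential v L x := by
  unfold periodizedPotential
  refine le_antisymm (iSup_le fun n => ENNReal.tsum_le_tsum fun m => truncPotential_le v n _) ?_
  -- monotone convergence for the lattice series: `∑' ⨆ₙ ≤ ⨆ₙ ∑'` through the finite partial sums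
  calc ∑' m : Fin 3 → ℤ, v ‖x - latticeVec L m‖
      = ∑' m : Fin 3 → ℤ, ⨆ n : ℕ, truncPotential v n ‖x - latticeVec L m‖ :=
        tsum_congr fun m => (iSup_truncPotential v _).symm
    _ = ⨆ s : Finset (Fin 3 → ℤ), ∑ m ∈ s, ⨆ n : ℕ, truncPotential v n ‖x - latticeVec L m‖ :=
        ENNReal.tsum_eq_iSup_sum
    _ ≤ ⨆ n : ℕ, ∑' m : Fin 3 → ℤ, truncPotential v n ‖x - latticeVec L m‖ := by
        refine iSup_le fun s => ?_
        rw [ENNReal.finsetSum_iSup_of_monotone (f := fun m n => truncPotential v n ‖x - latticeVec L m‖)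
          fun m => fun _ _ h => monotone_truncPotential v _ h]
        exact iSup_mono fun n => ENNReal.sum_le_tsum s

/-- The periodic interactions of the truncations increase with the truncation height. [folklore] -/
theorem monotone_periodicInteraction_truncPotential {N : ℕ} (v : ℝ → ℝ≥0∞) (L : ℝ) (X : Config N) :
    Monotone fun n : ℕ => periodicInteraction (truncPotential v n) L X :=
  fun _ _ h => Finset.sum_le_sum fun _ _ => Finset.sum_le_sum fun _ _ =>
    monotone_periodizedPotential_truncPotential v L _ h

/-- `⨆ₙ Wₙ = W` pointwise: the periodic interaction of `v` is the monotone limit of those of its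
truncations `min(v, n)`. [folklore] -/
theorem iSup_periodicInteraction_truncPotential {N : ℕ} (v : ℝ → ℝ≥0∞) (L : ℝ) (X : Config N) :
    ⨆ n : ℕ, periodicInteraction (truncPotential v n) L X = periodicInteraction v L X := by
  have hin : ∀ i : Fin N, Monotone fun n : ℕ =>
      ∑ j : Fin N with i < j, periodizedPotential (truncPotential v n) L (X i - X j) :=
    fun i _ _ h => Finset.sum_le_sum fun j _ => monotone_periodizedPotential_truncPotential v L _ h
  unfold periodicInteraction
  rw [← ENNReal.finsetSum_iSup_of_monotone hin]
  refine Finset.sum_congr rfl fun i _ => ?_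
  rw [← ENNReal.finsetSum_iSup_of_monotone fun j =>
    monotone_periodizedPotential_truncPotential v L (X i - X j)]
  exact Finset.sum_congr rfl fun j _ => iSup_periodizedPotential_truncPotential v L _

/-- The energies of a fixed trial state in the truncated potentials increase with the truncation
height. [folklore] -/
theorem monotone_periodicEnergy_truncPotential {N : ℕ} {L : ℝ} (v : ℝ → ℝ≥0∞)
    (Ψ : PeriodicTrialState N L) : Monotone fun n : ℕ => periodicEnergy (truncPotential v n) Ψ := by
  intro n n' h
  refine lintegral_mono fun X => ?_
  dsimp only
  gcongr
  exact monotone_periodicInteraction_truncPotential v L X h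

/-- `E_{vₙ}[Ψ] ≤ E_v[Ψ]`. [folklore] -/
theorem periodicEnergy_truncPotential_le' {N : ℕ} {L : ℝ} (v : ℝ → ℝ≥0∞) (n : ℕ)
    (Ψ : PeriodicTrialState N L) : periodicEnergy (truncPotential v n) Ψ ≤ periodicEnergy v Ψ := by
  refine lintegral_mono fun X => ?_
  dsimp only
  gcongr
  rw [← iSup_periodicInteraction_truncPotential v L X]
  exact le_iSup (fun n => periodicInteraction (truncPotential v n) L X) n

/-- The periodic interaction of a measurable profile is measurable. [folklore] -/
theorem measurable_periodicInteraction_trunc {N : ℕ} {v : ℝ → ℝ≥0∞} (hv : Measurable v) (L : ℝ) :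
    Measurable (periodicInteraction (N := N) v L) := by
  unfold periodicInteraction periodizedPotential
  refine Finset.measurable_sum _ fun i _ => Finset.measurable_sum _ fun j _ => ?_
  have hij : Measurable fun X : Config N => X i - X j := (measurable_pi_apply i).sub (measurable_pi_apply j)
  exact (Measurable.tsum fun n => hv.comp (measurable_id.sub_const _).norm).comp hij

/-- The integrand of `periodicEnergy` is measurable for a `C¹` state and a measurable profile.
[folklore] -/
theorem measurable_periodicEnergy_integrand {N : ℕ} {L : ℝ} {v : ℝ → ℝ≥0∞} (hv : Measurable v)
    (Ψ : PeriodicTrialState N L) : Measurable fun X =>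
      kineticDensity Ψ.ψ X + periodicInteraction v L X * (‖Ψ.ψ X‖₊ : ℝ≥0∞) ^ 2 := by
  refine Measurable.add ?_ ((measurable_periodicInteraction_trunc hv L).mul
    ((Ψ.contDiff.continuous.measurable.nnnorm.coe_nnreal_ennreal).pow_const 2))
  unfold kineticDensity
  refine Finset.measurable_sum _ fun i _ => Finset.measurable_sum _ fun k _ => ?_
  exact (((Ψ.contDiff.continuous_fderiv one_ne_zero).clm_apply continuous_const).measurable
    |>.nnnorm.coe_nnreal_ennreal).pow_const 2

/-- **Per-state monotone convergence**: `E_v[Ψ] = ⨆ₙ E_{min(v,n)}[Ψ]` for every periodic trial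
state (Beppo Levi). [folklore] -/
theorem iSup_periodicEnergy_truncPotential {N : ℕ} {L : ℝ} {v : ℝ → ℝ≥0∞} (hv : Measurable v)
    (Ψ : PeriodicTrialState N L) :
    ⨆ n : ℕ, periodicEnergy (truncPotential v n) Ψ = periodicEnergy v Ψ := by
  unfold periodicEnergy
  rw [← lintegral_iSup (fun n => measurable_periodicEnergy_integrand (measurable_truncPotential hv n) Ψ)
    (fun n n' h X => by
      dsimp only
      gcongr
      exact monotone_periodicInteraction_truncPotential v L X h)]
  refine lintegral_congr fun X => ?_
  rw [← iSup_periodicInteraction_truncPotential v L X, ENNReal.iSup_mul, ENNReal.add_iSup]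

/-- Per-state convergence as a limit: `E_{min(v,n)}[Ψ] → E_v[Ψ]`. [folklore] -/
theorem tendsto_periodicEnergy_truncPotential {N : ℕ} {L : ℝ} {v : ℝ → ℝ≥0∞} (hv : Measurable v)
    (Ψ : PeriodicTrialState N L) :
    Tendsto (fun n : ℕ => periodicEnergy (truncPotential v n) Ψ) atTop (nhds (periodicEnergy v Ψ)) := by
  rw [← iSup_periodicEnergy_truncPotential hv Ψ]
  exact tendsto_atTop_iSup (monotone_periodicEnergy_truncPotential v Ψ)

/-- The truncated ground-state energies increase with the truncation height. [folklore] -/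
theorem monotone_periodicGroundStateEnergy_truncPotential (v : ℝ → ℝ≥0∞) (N : ℕ) (L : ℝ) :
    Monotone fun n : ℕ => periodicGroundStateEnergy (truncPotential v n) N L :=
  fun _ _ h => iInf_mono fun Ψ => monotone_periodicEnergy_truncPotential v Ψ h

/-- `E₀(min(v,n)) ≤ E₀(v)`. [folklore] -/
theorem periodicGroundStateEnergy_truncPotential_le' (v : ℝ → ℝ≥0∞) (n N : ℕ) (L : ℝ) :
    periodicGroundStateEnergy (truncPotential v n) N L ≤ periodicGroundStateEnergy v N L :=
  iInf_mono fun Ψ => periodicEnergy_truncPotential_le' v n Ψ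

/-! ### The bounded case -/

/-- A bounded profile is eventually untouched by truncation: `min(v, n) = v` once `v ≤ n`.
[folklore] -/
theorem truncPotential_eq_self_of_le {v : ℝ → ℝ≥0∞} {n : ℕ} (h : ∀ r, v r ≤ n) :
    truncPotential v n = v :=
  funext fun r => min_eq_left (h r)

/-- **The stub for bounded profiles**: if `v ≤ M < ⊤` then `E₀(v) ≤ E₀(min(v,n)) + ε` for all
`n ≥ ⌈M⌉` and every `ε ≥ 0` (indeed with equality and `ε = 0`). [folklore] -/
theorem truncationLimit_of_bounded {v : ℝ → ℝ≥0∞} (hM : ∃ M : ℝ≥0∞, M ≠ ⊤ ∧ ∀ r, v r ≤ M)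
    (N : ℕ) (L : ℝ) {ε : ℝ} (hε : 0 ≤ ε) :
    ∃ n₁ : ℕ, ∀ n : ℕ, n₁ ≤ n →
      (periodicGroundStateEnergy v N L).toReal ≤
        (periodicGroundStateEnergy (truncPotential v n) N L).toReal + ε := by
  obtain ⟨M, hMtop, hvM⟩ := hM
  obtain ⟨n₁, hn₁⟩ := ENNReal.exists_nat_gt hMtop
  refine ⟨n₁, fun n hn => ?_⟩
  have hn' : (M : ℝ≥0∞) ≤ n := hn₁.le.trans (by exact_mod_cast hn)
  rw [truncPotential_eq_self_of_le fun r => (hvM r).trans hn']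
  linarith

/-! ### Two `liminf` inequalities in `ℝ≥0∞` -/

/-- `c · liminf uⱼ ≤ liminf (c · uⱼ)` in `ℝ≥0∞` (multiplication by a constant is monotone and
commutes with suprema). [folklore] -/
theorem mul_liminf_le (c : ℝ≥0∞) (u : ℕ → ℝ≥0∞) :
    c * liminf u atTop ≤ liminf (fun j => c * u j) atTop := by
  simp only [Filter.liminf_eq_iSup_iInf_of_nat, ENNReal.mul_iSup]
  exact iSup_mono fun n => le_iInf fun i => le_iInf fun hi => mul_le_mul' le_rfl (iInf₂_le i hi)

/-- `liminf uⱼ + liminf vⱼ ≤ liminf (uⱼ + vⱼ)` in `ℝ≥0∞`. [folklore] -/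
theorem liminf_add_liminf_le (u v : ℕ → ℝ≥0∞) :
    liminf u atTop + liminf v atTop ≤ liminf (fun j => u j + v j) atTop := by
  simp only [Filter.liminf_eq_iSup_iInf_of_nat]
  have hmono : ∀ w : ℕ → ℝ≥0∞, Monotone fun n => ⨅ i, ⨅ (_ : i ≥ n), w i :=
    fun w n m h => le_iInf fun i => le_iInf fun hi => iInf₂_le i (h.trans hi)
  rw [ENNReal.iSup_add_iSup_of_monotone (hmono u) (hmono v)]
  exact iSup_mono fun n => le_iInf fun i => le_iInf fun hi => add_le_add (iInf₂_le i hi) (iInf₂_le i hi)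

/-- Lower semicontinuity of weighted Fourier sums: if `gⱼ → η` in a Hilbert space then
`∑ᵢ wᵢ |⟨eᵢ, η⟩|² ≤ liminf ∑ᵢ wᵢ |⟨eᵢ, gⱼ⟩|²` (finite weights). [folklore] -/
theorem tsum_mul_inner_sq_le_liminf {ι E : Type*} [NormedAddCommGroup E] [InnerProductSpace ℂ E]
    (e : ι → E) {w : ι → ℝ≥0∞} (hw : ∀ i, w i ≠ ⊤) {g : ℕ → E} {η : E}
    (h : Tendsto g atTop (𝓝 η)) :
    ∑' i, w i * (‖⟪e i, η⟫_ℂ‖₊ : ℝ≥0∞) ^ 2 ≤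
      liminf (fun j => ∑' i, w i * (‖⟪e i, g j⟫_ℂ‖₊ : ℝ≥0∞) ^ 2) atTop := by
  rw [ENNReal.tsum_eq_iSup_sum]
  refine iSup_le fun s => ?_
  have hcont : Continuous fun x : E => ∑ i ∈ s, w i * (‖⟪e i, x⟫_ℂ‖₊ : ℝ≥0∞) ^ 2 := by
    refine continuous_finsetSum _ fun i _ => ?_
    exact (ENNReal.continuous_const_mul (hw i)).comp
      ((ENNReal.continuous_pow 2).comp
        (ENNReal.continuous_coe.comp (continuous_const.inner continuous_id).nnnorm))
  rw [← ((hcont.tendsto η).comp h).liminf_eq]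
  exact liminf_le_liminf (Eventually.of_forall fun j => ENNReal.sum_le_tsum s)

/-! ### Bose symmetry in momentum space -/

section Perm

variable {N : ℕ} {L : ℝ}

/-- Permuting the particle coordinates of the torus permutes the factors of a Fourier monomial:
`e_n(t ∘ (τ × id)) = e_{n ∘ (τ⁻¹ × id)}(t)`. [folklore] -/
theorem mFourier_comp_perm (n : Fin N × Fin 3 → ℤ) (τ : Equiv.Perm (Fin N)) (t : UnitAddTorus (Fin N × Fin 3)) :
    mFourier n (fun p : Fin N × Fin 3 => t (τ p.1, p.2)) = mFourier (fun p : Fin N × Fin 3 => n (τ.symm p.1, p.2)) t := by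
  simp only [mFourier, ContinuousMap.coe_mk]
  exact Fintype.prod_equiv (Equiv.prodCongr τ (Equiv.refl (Fin 3))) _ _ fun ⟨i, k⟩ => by simp

/-- The coordinate permutation `t ↦ t ∘ (σ⁻¹ × id)` of `(ℝ/ℤ)^{3N}` induced by a particle permutation
preserves every product measure `μ^{⊗ 3N}` (used with the Haar probability measure of `ℝ/ℤ`).
[folklore] -/
theorem measurePreserving_comp_perm (μ : Measure UnitAddCircle) [SigmaFinite μ] (σ : Equiv.Perm (Fin N)) :
    MeasurePreserving (MeasurableEquiv.arrowCongr' (Equiv.prodCongr σ (Equiv.refl (Fin 3)))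
      (MeasurableEquiv.refl UnitAddCircle))
      (Measure.pi fun _ : Fin N × Fin 3 => μ) (Measure.pi fun _ : Fin N × Fin 3 => μ) :=
  measurePreserving_arrowCongr' (fun _ => μ) (fun _ => μ) _ _ fun _ => MeasurePreserving.id μ

/-- Pointwise form of the coordinate permutation. [folklore] -/
theorem arrowCongr'_perm_apply (σ : Equiv.Perm (Fin N)) (t : UnitAddTorus (Fin N × Fin 3))
    (p : Fin N × Fin 3) :
    MeasurableEquiv.arrowCongr' (Equiv.prodCongr σ (Equiv.refl (Fin 3)))
      (MeasurableEquiv.refl UnitAddCircle) t p = t (σ.symm p.1, p.2) := rfl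

/-- Permuting the particles of the representative configuration: `fromUnitTorusN L (t ∘ (σ × id)) =
(fromUnitTorusN L t) ∘ σ`. [folklore] -/
theorem fromUnitTorusN_comp_perm (L : ℝ) (σ : Equiv.Perm (Fin N)) (t : UnitAddTorus (Fin N × Fin 3)) :
    fromUnitTorusN L (fun p : Fin N × Fin 3 => t (σ p.1, p.2)) = fromUnitTorusN L t ∘ σ := rfl

/-- **Bose symmetry in momentum space**: the cell Fourier coefficients of a permutation-symmetric
`N`-body function are invariant under permuting the particle indices of the momentum,
`ĉ_{n ∘ (σ × id)}(Ψ) = ĉ_n(Ψ)`. [folklore] -/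
theorem configFourierCoeff_perm {Ψ : Config N → ℂ} (hΨ : ∀ (σ : Equiv.Perm (Fin N)) (X : Config N), Ψ (X ∘ σ) = Ψ X)
    (σ : Equiv.Perm (Fin N)) (n : Fin N × Fin 3 → ℤ) :
    configFourierCoeff L Ψ (fun p => n (σ p.1, p.2)) = configFourierCoeff L Ψ n := by
  unfold configFourierCoeff mFourierCoeff torusFunN
  have h := (measurePreserving_comp_perm (N := N) AddCircle.haarAddCircle σ).integral_comp'
    (g := fun t : UnitAddTorus (Fin N × Fin 3) => mFourier (-n) t • Ψ (fromUnitTorusN L t))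
  refine Eq.trans ?_ h
  refine integral_congr_ae (Eventually.of_forall fun t => ?_)
  have ht : (MeasurableEquiv.arrowCongr' (Equiv.prodCongr σ (Equiv.refl (Fin 3)))
      (MeasurableEquiv.refl UnitAddCircle) t : UnitAddTorus (Fin N × Fin 3)) =
      fun p : Fin N × Fin 3 => t (σ.symm p.1, p.2) := funext fun p => arrowCongr'_perm_apply σ t p
  dsimp only
  rw [ht, fromUnitTorusN_comp_perm, hΨ, mFourier_comp_perm (-n) σ.symm t]
  rfl

end Perm

/-! ### Small free-gas facts (the free form domain is the compactness device of part 2) -/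

section Free

variable {N : ℕ} {L : ℝ}

/-- The free profile is measurable. [folklore] -/
theorem measurable_zeroProfile : Measurable (0 : ℝ → ℝ≥0∞) := measurable_const

/-- The free periodic interaction is integrable on the cell (it is `0`). [folklore] -/
theorem lintegral_periodicInteraction_zero_ne_top (N : ℕ) (L : ℝ) :
    ∫⁻ X in cellN N L, periodicInteraction (0 : ℝ → ℝ≥0∞) L X ≠ ⊤ := by
  simp [periodicInteraction_zeroPotential]

/-- The free energy of a trial state is its kinetic energy. [folklore] -/
theorem periodicEnergy_zero_eq (Ψ : PeriodicTrialState N L) :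
    periodicEnergy (0 : ℝ → ℝ≥0∞) Ψ = ∫⁻ X in cellN N L, kineticDensity Ψ.ψ X :=
  lintegral_congr fun X => by rw [periodicInteraction_zeroPotential, zero_mul, add_zero]

/-- The kinetic energy is at most the energy. [folklore] -/
theorem lintegral_kineticDensity_le_periodicEnergy (w : ℝ → ℝ≥0∞) (Ψ : PeriodicTrialState N L) :
    ∫⁻ X in cellN N L, kineticDensity Ψ.ψ X ≤ periodicEnergy w Ψ :=
  lintegral_mono fun _ => le_self_add

/-- `‖c z‖₊² = c² ‖z‖₊²` in `ℝ≥0∞` for a real scalar `c ≥ 0`. [folklore] -/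
theorem coe_nnnorm_real_mul_sq {c : ℝ} (hc : 0 ≤ c) (z : ℂ) :
    ((‖(c : ℂ) * z‖₊ : ℝ≥0∞)) ^ 2 = ENNReal.ofReal (c ^ 2) * (‖z‖₊ : ℝ≥0∞) ^ 2 := by
  rw [coe_nnnorm_sq_eq_ofReal, coe_nnnorm_sq_eq_ofReal, norm_mul, Complex.norm_real,
    Real.norm_of_nonneg hc, mul_pow, ENNReal.ofReal_mul (sq_nonneg _)]

/-- `L^{3N} · L^{-3N} = 1` in `ℝ≥0∞`. [folklore] -/
theorem ofReal_cellScale_sq_mul_inv (hL : 0 < L) (N : ℕ) :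
    ENNReal.ofReal (cellScale N L ^ 2) * ((ENNReal.ofReal L ^ 3)⁻¹) ^ N = 1 := by
  rw [cellScale_sq hL.le, ← ofReal_inv_pow_three_pow hL N, ← ENNReal.ofReal_mul (by positivity),
    ← mul_pow, mul_inv_cancel₀ (pow_ne_zero 3 hL.ne'), one_pow, ENNReal.ofReal_one]

end Free

/-! ### Registered sub-goal of the crux item (part 1/2) -/

/-- **Registered sub-goal `stub_truncationPerState`** (item stmt-AtomisticToContinuum-12057, line
`uv-thomson-force-wave`, support of S2 `TruncationLimit`): per-state monotone convergence of the
truncated periodic energies, `⨆ₙ E_{min(v,n)}[Ψ] = E_v[Ψ]` for every measurable profile and every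
periodic trial state (`iSup_periodicEnergy_truncPotential`). [folklore] -/
theorem stub_truncationPerState :
    ∀ (v : ℝ → ℝ≥0∞), Measurable v → ∀ (N : ℕ) (L : ℝ) (Ψ : PeriodicTrialState N L),
      ⨆ n : ℕ, periodicEnergy (truncPotential v n) Ψ = periodicEnergy v Ψ :=
  fun _v hv _N _L Ψ => iSup_periodicEnergy_truncPotential hv Ψ

end Summit.AtomisticToContinuum.BoseEinsteinCondensation.Cruxes.StaticResponseBound.UvThomsonForceWave

end
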